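import Mathlib.NumberTheory.DirichletCharacter.Orthogonality
import Mathlib.RingTheory.RootsOfUnity.AlgebraicallyClosed
import Mathlib.NumberTheory.Padics.PadicVal.Basic
import Mathlib.RingTheory.IntegralClosure.IntegrallyClosed
import Mathlib.FieldTheory.Finite.Basic
import Mathlib.Analysis.Complex.Polynomial.Basic
import HarnessLib

/-!
# Route `AdditiveKolyvaginRoad`, crux `ManinFrameResidueProperR` (stmt-BirchSwinnertonDyer-20709), line
# `birth`, stub TDS (`p ≥ 11`): arithmetic lemmas for the TAME-TWIST lever (`p`-integrality bookkeeping,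
# unit Euler factors, odd orthogonality) — `--supports`, helper

Cell `pub/bsd-wall`, seat `bsd-wall-manin-p1` g3. Elementary algebra used by the companion files
`…ManinFrameResidueProperRTameTwistGamma0.lean` / `…ManinFrameResidueProperRTameTwist.lean`, which
remove the unit-twist hypothesis K4 from the predecessor's Euler-system lever
(`…ManinFrameResidueProperRUnitTwist.lean`): Manin's `p`-part at a lattice-optimal datum follows from
Kato's integral zeta elements read in Néron units for ALL tame characters of order prime to `p`, as soon
as no multiplicative prime `ℓ ∥ N` has `ord_p(ℓ / a_ℓ)` a power of `2`.

* §1 `p`-integrality of complex algebraic numbers, in the portable form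
  `∃ s : ℕ, ¬ p ∣ s ∧ IsIntegral ℤ (s · z)` (closed under `+`, `·`, and detecting `0 ≤ ord_p q`
  on rationals `q`).
* §2 The `N`-imprimitivity Euler factors `ℓ − a ζ` (`ζ` a root of unity of order dividing `n`) are
  `p`-units as soon as `p ∤ ℓⁿ − aⁿ`: `(ℓ − aζ) · Σ ℓ^i (aζ)^{n−1−i} = ℓⁿ − aⁿ`; and
  `p ∣ ℓⁿ − aⁿ` forces `ord_p(ℓ/a) ∣ gcd(n, p − 1)`, a power of `2` when `n` avoids the odd primes
  of `p − 1`.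
* §3 Orthogonality over the ODD Dirichlet characters modulo `d`:
  `2 Σ_{χ odd} χ(b⁻¹) χ(a) = φ(d)(𝟙_{a = b} − 𝟙_{a = −b})`.

Everything is proved; no named fact, no definition.
-/

set_option autoImplicit false
set_option linter.dupNamespace false

noncomputable section

open scoped Classical

namespace Summit.BirchSwinnertonDyer.BirchSwinnertonDyer.Theorems.ManinFrameResidueProperRTameTwist

/-! ### §1 `p`-integrality bookkeeping: `∃ s, p ∤ s ∧ IsIntegral ℤ (s · z)` -/

section PInt

variable {p : ℕ}

/-- Integral elements are `p`-integral (`s = 1`). [folklore] -/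
theorem pint_of_isIntegral (hp : p.Prime) {z : ℂ} (hz : IsIntegral ℤ z) :
    ∃ s : ℕ, ¬ p ∣ s ∧ IsIntegral ℤ ((s : ℂ) * z) :=
  ⟨1, fun h ↦ hp.one_lt.ne' (Nat.dvd_one.mp h), by simpa using hz⟩

/-- `p`-integral elements are closed under addition. [folklore] -/
theorem pint_add (hp : p.Prime) {z w : ℂ} (hz : ∃ s : ℕ, ¬ p ∣ s ∧ IsIntegral ℤ ((s : ℂ) * z))
    (hw : ∃ s : ℕ, ¬ p ∣ s ∧ IsIntegral ℤ ((s : ℂ) * w)) :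
    ∃ s : ℕ, ¬ p ∣ s ∧ IsIntegral ℤ ((s : ℂ) * (z + w)) := by
  obtain ⟨s, hs, hsz⟩ := hz
  obtain ⟨t, ht, htw⟩ := hw
  refine ⟨s * t, fun h ↦ (hp.dvd_mul.mp h).elim hs ht, ?_⟩
  have ht' : IsIntegral ℤ ((t : ℤ) : ℂ) := isIntegral_algebraMap
  have hs' : IsIntegral ℤ ((s : ℤ) : ℂ) := isIntegral_algebraMap
  have h1 : IsIntegral ℤ (((t : ℤ) : ℂ) * ((s : ℂ) * z)) := ht'.mul hsz
  have h2 : IsIntegral ℤ (((s : ℤ) : ℂ) * ((t : ℂ) * w)) := hs'.mul htw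
  have key : ((s * t : ℕ) : ℂ) * (z + w) = ((t : ℤ) : ℂ) * ((s : ℂ) * z) + ((s : ℤ) : ℂ) * ((t : ℂ) * w) := by
    push_cast; ring
  rw [key]
  exact h1.add h2

/-- `p`-integral elements are closed under multiplication. [folklore] -/
theorem pint_mul (hp : p.Prime) {z w : ℂ} (hz : ∃ s : ℕ, ¬ p ∣ s ∧ IsIntegral ℤ ((s : ℂ) * z))
    (hw : ∃ s : ℕ, ¬ p ∣ s ∧ IsIntegral ℤ ((s : ℂ) * w)) :
    ∃ s : ℕ, ¬ p ∣ s ∧ IsIntegral ℤ ((s : ℂ) * (z * w)) := by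
  obtain ⟨s, hs, hsz⟩ := hz
  obtain ⟨t, ht, htw⟩ := hw
  refine ⟨s * t, fun h ↦ (hp.dvd_mul.mp h).elim hs ht, ?_⟩
  have key : ((s * t : ℕ) : ℂ) * (z * w) = (s : ℂ) * z * ((t : ℂ) * w) := by push_cast; ring
  rw [key]
  exact hsz.mul htw

/-- A finite sum of `p`-integral elements is `p`-integral. [folklore] -/
theorem pint_sum (hp : p.Prime) {ι : Type*} (s : Finset ι) (z : ι → ℂ)
    (h : ∀ i ∈ s, ∃ t : ℕ, ¬ p ∣ t ∧ IsIntegral ℤ ((t : ℂ) * z i)) :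
    ∃ t : ℕ, ¬ p ∣ t ∧ IsIntegral ℤ ((t : ℂ) * ∑ i ∈ s, z i) := by
  induction s using Finset.induction_on with
  | empty => exact ⟨1, fun h ↦ hp.one_lt.ne' (Nat.dvd_one.mp h), by simp [isIntegral_zero]⟩
  | insert a s ha ih =>
    rw [Finset.sum_insert ha]
    exact pint_add hp (h a (Finset.mem_insert_self a s))
      (ih fun i hi ↦ h i (Finset.mem_insert_of_mem hi))

/-- Dividing by a natural number prime to `p` preserves `p`-integrality: if `p ∤ n` and `n · z` is
`p`-integral then so is `z`. [folklore] -/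
theorem pint_of_pint_natCast_mul (hp : p.Prime) {n : ℕ} (hn : ¬ p ∣ n) {z : ℂ}
    (hz : ∃ s : ℕ, ¬ p ∣ s ∧ IsIntegral ℤ ((s : ℂ) * ((n : ℂ) * z))) :
    ∃ s : ℕ, ¬ p ∣ s ∧ IsIntegral ℤ ((s : ℂ) * z) := by
  obtain ⟨s, hs, hsz⟩ := hz
  refine ⟨s * n, fun h ↦ (hp.dvd_mul.mp h).elim hs hn, ?_⟩
  have key : ((s * n : ℕ) : ℂ) * z = (s : ℂ) * ((n : ℂ) * z) := by push_cast; ring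
  rw [key]
  exact hsz

/-- `p`-unit Euler factors may be cancelled: if `e · w = t` with `w` integral, `t ∈ ℤ`, `p ∤ t`, and
`e · z` is `p`-integral, then `z` is `p`-integral (`t z = (e z) w`). [folklore] -/
theorem pint_of_pint_mul_of_mul_eq (hp : p.Prime) {e w z : ℂ} {t : ℤ} (hw : IsIntegral ℤ w)
    (het : e * w = t) (ht : ¬ (p : ℤ) ∣ t)
    (hz : ∃ s : ℕ, ¬ p ∣ s ∧ IsIntegral ℤ ((s : ℂ) * (e * z))) :
    ∃ s : ℕ, ¬ p ∣ s ∧ IsIntegral ℤ ((s : ℂ) * z) := by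
  obtain ⟨s, hs, hsz⟩ := hz
  refine ⟨s * t.natAbs, fun h ↦ (hp.dvd_mul.mp h).elim hs fun h' ↦ ht ?_, ?_⟩
  · exact Int.natCast_dvd.mpr (by simpa using h')
  -- `s t z = (s e z) w` is integral, and `s |t| z = ± s t z`
  have hint : IsIntegral ℤ ((s : ℂ) * (t : ℂ) * z) := by
    have key : (s : ℂ) * (e * z) * w = (s : ℂ) * (t : ℂ) * z := by rw [← het]; ring
    rw [← key]
    exact hsz.mul hw
  have hnat : ((s * t.natAbs : ℕ) : ℂ) * z = (s : ℂ) * ((|t| : ℤ) : ℂ) * z := by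
    rw [Nat.cast_mul, Nat.cast_natAbs]
  rw [hnat]
  rcases abs_choice t with h | h
  · rw [h]; exact hint
  · rw [h, Int.cast_neg, mul_neg, neg_mul]; exact hint.neg

/-- On rationals, `p`-integrality is `0 ≤ ord_p`: if `s · q` is an algebraic integer for some `s`
prime to `p`, then `0 ≤ ord_p q`. [folklore] -/
theorem padicValRat_nonneg_of_pint [hp : Fact p.Prime] {q : ℚ}
    (h : ∃ s : ℕ, ¬ p ∣ s ∧ IsIntegral ℤ ((s : ℂ) * (q : ℂ))) : 0 ≤ padicValRat p q := by
  obtain ⟨s, hs, hsq⟩ := h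
  by_cases hq : q = 0
  · simp [hq]
  have hs0 : s ≠ 0 := by rintro rfl; exact hs (dvd_zero p)
  -- `s q ∈ ℤ`
  have hsq' : IsIntegral ℤ (algebraMap ℚ ℂ ((s : ℚ) * q)) := by
    rw [map_mul]; simpa using hsq
  rw [isIntegral_algebraMap_iff (algebraMap ℚ ℂ).injective] at hsq'
  obtain ⟨z, hz⟩ := IsIntegrallyClosed.isIntegral_iff.mp hsq'
  have hz' : (z : ℚ) = s * q := by simpa using hz
  have hz0 : z ≠ 0 := by
    rintro rfl
    simp only [Int.cast_zero, zero_eq_mul, Nat.cast_eq_zero] at hz'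
    exact hz'.elim hs0 hq
  have hval : padicValRat p q = padicValRat p (z : ℚ) := by
    rw [hz', padicValRat.mul (by exact_mod_cast hs0) hq, padicValRat.of_nat,
      padicValNat.eq_zero_of_not_dvd hs]
    simp
  rw [hval, padicValRat.of_int]
  exact_mod_cast Nat.zero_le _

end PInt

/-! ### §2 The imprimitivity Euler factors `ℓ − a ζ` are `p`-units off the `2`-power orders -/

section EulerFactor

variable {p : ℕ}

/-- A root of unity is an algebraic integer (root of the monic `Xⁿ − 1`). [folklore] -/
theorem isIntegral_of_pow_eq_one {ζ : ℂ} {n : ℕ} (hn : 0 < n) (hζ : ζ ^ n = 1) : IsIntegral ℤ ζ := by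
  refine ⟨Polynomial.X ^ n - 1, Polynomial.monic_X_pow_sub_C 1 hn.ne', ?_⟩
  simp [hζ]

/-- **The Euler factor `ℓ − aζ` divides `ℓⁿ − aⁿ` with an integral cofactor** when `ζⁿ = 1`:
`(ℓ − aζ) · Σ_{i<n} ℓ^i (aζ)^{n−1−i} = ℓⁿ − (aζ)ⁿ = ℓⁿ − aⁿ`. [folklore] -/
theorem exists_eulerFactor_mul_eq (ℓ a : ℤ) {ζ : ℂ} {n : ℕ} (hn : 0 < n) (hζ : ζ ^ n = 1) :
    ∃ w : ℂ, IsIntegral ℤ w ∧ ((ℓ : ℂ) - a * ζ) * w = ((ℓ ^ n - a ^ n : ℤ) : ℂ) := by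
  refine ⟨∑ i ∈ Finset.range n, (ℓ : ℂ) ^ i * ((a : ℂ) * ζ) ^ (n - 1 - i), ?_, ?_⟩
  · refine IsIntegral.sum _ fun i _ ↦ ?_
    exact ((isIntegral_algebraMap (x := ℓ)).pow _).mul
      (((isIntegral_algebraMap (x := a)).mul (isIntegral_of_pow_eq_one hn hζ)).pow _)
  · rw [Commute.mul_geom_sum₂ (Commute.all _ _), mul_pow, hζ, mul_one]
    push_cast
    ring

/-- **`p ∤ ℓⁿ − aⁿ` off the `2`-power orders.** Let `p` be a prime, `ℓ` prime to `p`, and suppose no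
`2`-power of `ℓ/a (mod p)` is `1` (i.e. `ord_p(ℓ/a)` is not a power of `2`, or `p ∣ a`). If every
odd prime factor of `p − 1` fails to divide `n ≠ 0`, then `p ∤ ℓⁿ − aⁿ`: otherwise `(ℓ/a)ⁿ = 1`, so
`ord_p(ℓ/a)` divides `gcd(n, p − 1)`, whose prime factors are all `2`. [folklore] -/
theorem not_dvd_pow_sub_pow [hp : Fact p.Prime] {ℓ a : ℤ} (hℓ : ((ℓ : ZMod p)) ≠ 0)
    (hA : ∀ j : ℕ, ((ℓ : ZMod p) / (a : ZMod p)) ^ 2 ^ j ≠ 1) {n : ℕ} (hn : n ≠ 0)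
    (hr : ∀ r : ℕ, r.Prime → r ≠ 2 → r ∣ p - 1 → ¬ r ∣ n) : ¬ (p : ℤ) ∣ ℓ ^ n - a ^ n := by
  intro hdvd
  have h0 : ((ℓ : ZMod p)) ^ n = ((a : ZMod p)) ^ n := by
    have : (((ℓ ^ n - a ^ n : ℤ)) : ZMod p) = 0 := (ZMod.intCast_zmod_eq_zero_iff_dvd _ p).mpr hdvd
    push_cast at this
    exact sub_eq_zero.mp this
  by_cases ha : ((a : ZMod p)) = 0
  · rw [ha, zero_pow hn] at h0
    exact pow_ne_zero n hℓ h0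
  set u : ZMod p := (ℓ : ZMod p) / (a : ZMod p) with hu
  have hu1 : u ^ n = 1 := by
    rw [hu, div_pow, h0, div_self (pow_ne_zero n ha)]
  have hu0 : u ≠ 0 := by
    rw [hu]; exact div_ne_zero hℓ ha
  -- `ord u ∣ n` and `ord u ∣ p − 1`
  have hord_n : orderOf u ∣ n := orderOf_dvd_of_pow_eq_one hu1
  have hord_p : orderOf u ∣ p - 1 := orderOf_dvd_of_pow_eq_one (ZMod.pow_card_sub_one_eq_one hu0)
  have hordpos : 0 < orderOf u := orderOf_pos_iff.mpr (isOfFinOrder_iff_pow_eq_one.mpr ⟨n, Nat.pos_of_ne_zero hn, hu1⟩)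
  -- `ord u = 2^k · m` with `m` odd; `m = 1` since an odd prime factor of `m` would divide `n` and `p − 1`
  obtain ⟨k, m, hm, hkm⟩ := Nat.exists_eq_two_pow_mul_odd hordpos.ne'
  have hm1 : m = 1 := by
    by_contra hm1
    obtain ⟨r, hrp, hrm⟩ := Nat.exists_prime_and_dvd hm1
    have hr2 : r ≠ 2 := by
      rintro rfl
      exact (Nat.not_even_iff_odd.mpr hm) (even_iff_two_dvd.mpr hrm)
    have hrord : r ∣ orderOf u := hkm ▸ dvd_mul_of_dvd_right hrm _
    exact hr r hrp hr2 (hrord.trans hord_p) (hrord.trans hord_n)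
  rw [hm1, mul_one] at hkm
  exact hA k (by rw [← hkm]; exact pow_orderOf_eq_one u)

/-- **Unit Euler factor, packaged for cancellation.** Under the hypotheses of `not_dvd_pow_sub_pow`
and `ζⁿ = 1`: `(ℓ − aζ) · w = t` with `w` integral, `t ∈ ℤ`, `p ∤ t`. [folklore] -/
theorem exists_eulerFactor_mul_eq_of_not_twoPow [hp : Fact p.Prime] {ℓ a : ℤ}
    (hℓ : ((ℓ : ZMod p)) ≠ 0) (hA : ∀ j : ℕ, ((ℓ : ZMod p) / (a : ZMod p)) ^ 2 ^ j ≠ 1)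
    {n : ℕ} (hn : 0 < n) (hr : ∀ r : ℕ, r.Prime → r ≠ 2 → r ∣ p - 1 → ¬ r ∣ n)
    {ζ : ℂ} (hζ : ζ ^ n = 1) :
    ∃ (w : ℂ) (t : ℤ), IsIntegral ℤ w ∧ ((ℓ : ℂ) - a * ζ) * w = t ∧ ¬ (p : ℤ) ∣ t := by
  obtain ⟨w, hw, hwt⟩ := exists_eulerFactor_mul_eq ℓ a hn hζ
  exact ⟨w, ℓ ^ n - a ^ n, hw, hwt, not_dvd_pow_sub_pow hℓ hA hn.ne' hr⟩

end EulerFactor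

/-! ### §3 Orthogonality over the odd characters -/

section OddOrthogonality

variable {d : ℕ} [NeZero d]

/-- **Orthogonality over the ODD Dirichlet characters modulo `d`**: for a unit `b` and any `a`,
`2 · Σ_{χ odd} χ(b⁻¹) χ(a) = φ(d) 𝟙_{a = b} − φ(d) 𝟙_{a = −b}`
(`𝟙_odd(χ) = (1 − χ(−1))/2` and Mathlib's `DirichletCharacter.sum_char_inv_mul_char_eq` at `a` and
`−a`). [folklore] -/
theorem two_mul_sum_odd_char_inv_mul_char (b : ZMod d) (hb : IsUnit b) (a : ZMod d) :
    2 * ∑ χ ∈ (Finset.univ : Finset (DirichletCharacter ℂ d)) with χ.Odd, χ b⁻¹ * χ a =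
      (if b = a then (d.totient : ℂ) else 0) - (if b = -a then (d.totient : ℂ) else 0) := by
  -- indicator of odd characters: `2 · 𝟙_odd = 1 − χ(−1)`
  have hind : ∀ χ : DirichletCharacter ℂ d,
      (2 : ℂ) * (if χ.Odd then χ b⁻¹ * χ a else 0) = χ b⁻¹ * χ a - χ b⁻¹ * χ (-a) := by
    intro χ
    rcases χ.even_or_odd with h | h
    · rw [if_neg (h.not_odd), h.eval_neg]; ring
    · rw [if_pos h, h.eval_neg]; ring
  rw [Finset.sum_filter, Finset.mul_sum]
  simp_rw [hind]
  rw [Finset.sum_sub_distrib, DirichletCharacter.sum_char_inv_mul_char_eq ℂ hb a,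
    DirichletCharacter.sum_char_inv_mul_char_eq ℂ hb (-a)]

end OddOrthogonality

end Summit.BirchSwinnertonDyer.BirchSwinnertonDyer.Theorems.ManinFrameResidueProperRTameTwist

end
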